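import Mathlib.Tactic.Linarith
import Mathlib.Tactic.NormNum
import Mathlib.Tactic.Ring
import Mathlib.Algebra.BigOperators.Group.Finset.Basic
import HarnessLib

/-!
# The (0,1) cell of the ι-window, XXVIII-B: the product ground `B₁ × B₂`, XV (ADDENDUM 1) — the node axis: the dimension count for split conductor
# curves, the non-pull-back torsion, the matched strata [n n] / [n t] (report [XXVIII] §14): arithmetic shadows

Family `hodge`, b2b cell `hweil` (helper of item stmt-HodgeConjecture-2524). Companion (`pg15a_*`) of `WeilTypeLadderH2ProductGroundFifteen.lean` (same
seat). Report `run/shared/lean/b2b/hodge-weil/b2b-hweil-pv1-g40/H2-ZERO-ONE-28.md` ([XXVIII]) §14 (ADDENDUM 1). HONEST FRAMING: census results inside the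
ladder's H2 test ((0,1) cell) on the SPECIAL fourfold `X₀ = B₁ × B₂`; nothing here is a rung; no case of the Hodge conjecture is proved; no statement of
[Markman 2025] / [Perry 2026] / [EdGFS 2025] is used. Every theorem is a def-free arithmetic identity that the report cites at the step named in its
docstring; none claims geometry.
-/

-- mandated namespace `Summit.HodgeConjecture.HodgeConjecture.…` (Problem = Summit) trips `linter.dupNamespace`; the lakefile disables it
-- tree-wide (weak option), restated here so stand-alone elaboration is warning-free too.
set_option linter.dupNamespace false

open Finset

namespace Summit.HodgeConjecture.HodgeConjecture.WeilTypeLadder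

section ProductGroundFifteenAdd1

/-- **ERRATUM / LEMMA WT ([XXVIII] 14.1): the local degree.** Near `ℓ_q` one has `𝒪(W̃) ≅ 𝒪(v_w D₂ + h_q D₃)` with `D₂·ℓ_q = −1`, `D₃·ℓ_q = −2`, so the degree on
`ℓ_q` is `v_w·(−1) + h_q·(−2) = −v_w − 2h_q = d`; and a monomial `λ^i v^j β^k` in `𝒪(aD₂ + bD₃)` (`j ≥ −a`, `k ≥ −b`, `0 ≤ i ≤ j + 2k`) reindexed by `j = j′ − a`,
`k = k′ − b` has `i ≤ j′ + 2k′ + d` with `d = −a − 2b`: the weight-`(j′,k′)` line bundle is `𝒪(d + j′ + 2k′)`. The four classes: `(v_w, h_{q₀}) = (1,−1), (0,−1),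
(−1,1), (0,1)` give `d_{q₀} = 1, 2, −1, −2` and `d_other = −v_w = −1, 0, 1, 0`. [`ring` / `norm_num`] -/
theorem pg15a_erratum_degree :
    (∀ v h : ℤ, v * (-1) + h * (-2) = -v - 2 * h) ∧
    (∀ a b i j' k' : ℤ, i ≤ (j' - a) + 2 * (k' - b) ↔ i ≤ j' + 2 * k' + (-a - 2 * b)) ∧
    ((-(1:ℤ) - 2 * (-1) = 1 ∧ -(0:ℤ) - 2 * (-1) = 2 ∧ -(-1:ℤ) - 2 * 1 = -1 ∧ -(0:ℤ) - 2 * 1 = -2) ∧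
     (-(1:ℤ) = -1 ∧ -(0:ℤ) = 0 ∧ -(-1:ℤ) = 1)) := by
  refine ⟨fun v h => by ring, fun a b i j' k' => ?_, by norm_num⟩
  constructor <;> intro h <;> linarith

/-- **LEMMA SPLIT ([XXVIII] 14.2): the dimension count for split conductor curves.** (d) Supports admitting a split half over a member `C₂ ∈ |2Θ₀(B₂)|`
through no base point lie in the image of a variety of dimension `3` (`C₂`) `+ 1 + 1` (`D₁, D₂` in the pencils with `D_i|_{C₂} = 2E_i`) `+ 1` (`φ` with two
prescribed values) `+ 2` (`ℓ₁`) `= 8 < 9 = dim S_N`; the thirty pencils give `1 + 1 + 1 + 1 + 2 = 6`; (c) paired theta halves: `(4 + 3) − 4 + 2 = 5`; the number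
of odd theta characteristics of a genus-5 curve `2^{g−1}(2^g − 1) = 16 · 31 = 496`; (b) a member meets a branch member in `8 − k` points off the `k` base points it
contains, `= 0` iff `k = 8`; (e) the half-weights `1/2` (theta), `1` (`C₂`), `3/2` (`C₃`): `3` is odd, `3 + 1` is even, and `2m` is even. [`norm_num` / `omega`] -/
theorem pg15a_split_count :
    ((3:ℤ) + 1 + 1 + 1 + 2 = 8 ∧ (8:ℤ) < 9 ∧ (1:ℤ) + 1 + 1 + 1 + 2 = 6 ∧ ((4:ℤ) + 3) - 4 + 2 = 5) ∧
    (2 ^ (5 - 1) * (2 ^ 5 - 1) = 496) ∧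
    (∀ k : ℕ, k ≤ 8 → (8 - k = 0 ↔ k = 8)) ∧
    ((3:ℤ) % 2 = 1 ∧ ((3:ℤ) + 1) % 2 = 0 ∧ ∀ m : ℤ, (2 * m) % 2 = 0) := by
  refine ⟨by norm_num, by norm_num, fun k hk => by omega, by norm_num, by norm_num, fun m => by omega⟩

/-- **[XXVIII] 14.2 REMARK (β): the torsion on a pull-back conductor curve is never a pull-back when `v_w = 0`.** On the double cover
`Δ̃_Θ → Θ̃_κ`, ramified at `r = 2(4 − b)` points (`b ∈ {0, 2}` base points on `Θ_κ`), the class `η|_{Δ̃_Θ}` is the sum `R_I` of the `|I| = 4 − b` ramification points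
over the branch member `D₁`; `R_I` is a pull-back iff `I = ∅` or `I` = all, and here `0 < 4 − b < 8 − 2b` for `b ≤ 2` (indeed for `b < 4`). Also the degree check:
`deg η|_{Δ̃_Θ} = Θ̃_κ · f₂ = 4 − b = |I|`. [`omega`] -/
theorem pg15a_RI_proper :
    (∀ b : ℕ, b < 4 → 0 < 4 - b ∧ 4 - b < 8 - 2 * b) ∧ ((4:ℕ) - 0 = 4 ∧ (4:ℕ) - 2 = 2 ∧ (8:ℕ) - 2 * 0 = 8 ∧ (8:ℕ) - 2 * 2 = 4) := by
  refine ⟨fun b hb => by omega, by norm_num⟩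

/-- **PROPOSITION N-X1 ([XXVIII] 14.3): the matched strata [n n], [n t] — transport count.** One match is one condition on the 9-dimensional node-axis
stratum: the matched stratum has dimension `9 − 1 = 8`; FZ's step (d1) still has `20 − 1 = 19 ≥ 1` unmatched critical values of `ℓ₂`; a row uses at most
`3 + 1 = 4` further conditions, so `e₁^ι ≥ 8 − 4 = 4 ≥ 2`; the unbalanced row at the matched fixed point has local index `0 − (−16) = 16 ≠ 0` ([XXV] 14.4:
`16 · H(−1)` with `H(t) = (1 + 3t)/(1 − t)` for four concurrent lines, `H(−1) = (1 − 3)/2 = −1`), while a single nodal fibre curve (two lines,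
`H = (1+t)/(1−t)`, `H(−1) = 0`) is balanced. [`norm_num`] -/
theorem pg15a_matched_transport :
    ((9:ℤ) - 1 = 8 ∧ (20:ℤ) - 1 = 19 ∧ (1:ℤ) ≤ 19 ∧ (3:ℤ) + 1 = 4 ∧ (8:ℤ) - 4 = 4 ∧ (2:ℤ) ≤ 4) ∧
    ((0:ℤ) - (-16) = 16 ∧ (16:ℤ) ≠ 0 ∧ (16:ℚ) * ((1 + 3 * (-1)) / (1 - (-1))) = -16 ∧ (16:ℚ) * ((1 + (-1)) / (1 - (-1))) = 0) := by
  refine ⟨by norm_num, by norm_num⟩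

end ProductGroundFifteenAdd1

end Summit.HodgeConjecture.HodgeConjecture.WeilTypeLadder
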